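import Literature.MathematicalPhysics.QuantumLattice.HubbardPartitionFunctionMatsubaraLimit
import Literature.MathematicalPhysics.QuantumLattice.HubbardTwoPointMoments
import Mathlib.MeasureTheory.Measure.Haar.Unique
import HarnessLib

/-!
# The Grassmann two-point numerator of the Hubbard torus: the `M → ∞` limit of its exponential series

Topic `MathematicalPhysics/QuantumLattice`; the two-point level of the `M → ∞` ("Matsubara UV") bridge, series part
(after `HubbardGrassmannMomentSeriesLimit` for the partition function and `HubbardTwoPointMoments` for the per-order
two-point moments).  For external fields at equal times `0`,
`N_M(U) := ∫dμ_{C_M} ψ⁺_{(x⃗ₑ,0)σ} ψ⁻_{(y⃗ₑ,0)σ'} e^{-V_M(U)}`: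

* `gaussExpect_mul_grassmannExp_neg_eq_tsum` — the exponential series with an insertion (finite, `constPart V = 0`);
* odd-size Hadamard `norm_det_le_of_entry_le_odd`; `inv_factorial_mul_pow_odd_le`, `summable_twoPointBound`;
* `norm_gaussExpect_twoPoint_pow_le` — `‖∫dμ_{C_M}ψ⁺ψ⁻Vⁿ‖ ≤ (|U|L²β)ⁿ((2n+1)B²)^{n+1}` UNIFORMLY in `M`;
* **`tendsto_gaussExpect_twoPoint_mul_grassmannExp`** — for `β > 0`, `3e|U|L²βB² < 1`, `N_M(U)` converges to the
  absolutely convergent determinant series `Σ'_n ((−1)ⁿ/n!) Uⁿ Σ_{x⃗} ∫_{[0,β]ⁿ} det[vertexLimitEntry on the 2n+1 pairs]`;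
* `setIntegral_unit_cube_comp_one_sub` (reflection `u ↦ 1 − u` of the unit cube); **`twoPointLimitDet`** (the limiting
  two-point Wick determinant) with `measurable_`, `norm_…_le`, `…_perm`, `sum_twoPointLimitDet_perm` (the vertex sum
  is symmetric in the vertex times), integrability on the cube and in the reflected scaled variables `τ = β(1−u)`.

The identification of the limit with the Hamiltonian two-point trace is `HubbardTwoPointMatsubaraLimit`.

## Sources

G. Benfatto, A. Giuliani, V. Mastropietro, Ann. Henri Poincaré 7 (2006) 809–898 = arXiv:cond-mat/0507686, §2.1
(2.5)–(2.8) [`BenfattoGiulianiMastropietro2006`]; J. Feldman, H. Knörrer, E. Trubowitz, *Fermionic Functional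
Integrals and the Renormalization Group* (2002), §I.3 [`FeldmanKnorrerTrubowitz2002`].
-/

noncomputable section

namespace Literature.MathematicalPhysics.QuantumLattice

open GrassmannAlgebra Finset Filter _root_.MeasureTheory Literature.Probability.LatticeModels _root_.Topology NormedSpace
open scoped Nat Pointwise ComplexOrder

/-! ### A. The exponential series with an insertion; odd-size Hadamard; domination -/

section Series

variable {Γ : Type*} [Fintype Γ]

/-- **The exponential series with an insertion**: for `V` without constant part and any `A`,
`∫dμ_C (A e^{−V}) = Σ'_n (−1)ⁿ/n! ∫dμ_C (A Vⁿ)` (a finite sum). [cite: BenfattoGiulianiMastropietro2006, §2.1 (2.8)] -/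
theorem gaussExpect_mul_grassmannExp_neg_eq_tsum (C : Matrix Γ Γ ℂ) (A : GrassmannAlgebra ℂ Γ) {V : GrassmannAlgebra ℂ Γ}
    (hV0 : constPart ℂ V = 0) :
    gaussExpect ℂ C (A * grassmannExp (-V)) = ∑' n : ℕ, ((-1 : ℂ) ^ n * ((n ! : ℂ))⁻¹) * gaussExpect ℂ C (A * V ^ n) := by
  have hnil : (-V) ^ (Fintype.card Γ + 1) = 0 :=
    pow_card_succ_eq_zero_of_constPart_eq_zero ℂ (by rw [map_neg, hV0, neg_zero])
  have hVnil : V ^ (Fintype.card Γ + 1) = 0 := pow_card_succ_eq_zero_of_constPart_eq_zero ℂ hV0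
  rw [tsum_eq_sum (s := Finset.range (Fintype.card Γ + 1))]
  · rw [grassmannExp, IsNilpotent.exp_eq_sum hnil, Finset.mul_sum, map_sum]
    refine sum_congr rfl fun n _ => ?_
    rw [← Rat.cast_smul_eq_qsmul ℂ, mul_smul_comm, map_smul, smul_eq_mul, ← neg_one_smul ℂ V, smul_pow,
      mul_smul_comm, map_smul, smul_eq_mul, Rat.cast_inv, Rat.cast_natCast]
    ring
  · intro n hn
    rw [Finset.mem_range, not_lt] at hn
    rw [pow_eq_zero_of_le hn hVnil, mul_zero, map_zero, mul_zero]

/-- **Hadamard, odd size**: if the entries of a `(2n+1)`-matrix are bounded by `B` with `1 ≤ (2n+1)B²` then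
`‖det A‖ ≤ ((2n+1)B²)^{n+1}`. [cite: FeldmanKnorrerTrubowitz2002, §I.3] -/
theorem norm_det_le_of_entry_le_odd {n : ℕ} (A : Matrix (Fin (n * 2 + 1)) (Fin (n * 2 + 1)) ℂ) {B : ℝ}
    (h1 : 1 ≤ ((n * 2 + 1 : ℕ) : ℝ) * B ^ 2) (h : ∀ i j, ‖A i j‖ ≤ B) :
    ‖A.det‖ ≤ (((n * 2 + 1 : ℕ) : ℝ) * B ^ 2) ^ (n + 1) := by
  have hsq := Literature.Analysis.Matrix.norm_det_sq_le_of_entry_le A (fun _ => B) h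
  rw [Finset.prod_const, Finset.card_univ, Fintype.card_fin] at hsq
  have h2 : (((n * 2 + 1 : ℕ) : ℝ) * B ^ 2) ^ (n * 2 + 1) ≤ ((((n * 2 + 1 : ℕ) : ℝ) * B ^ 2) ^ (n + 1)) ^ 2 := by
    rw [← pow_mul]
    exact pow_le_pow_right₀ h1 (by omega)
  exact (pow_le_pow_iff_left₀ (norm_nonneg _) (by positivity) two_ne_zero).1 (hsq.trans h2)

/-- `(n!)⁻¹ aⁿ ((2n+1)b)^{n+1} ≤ 3e·b·(n+1)·(3e·a·b)ⁿ` for `a, b ≥ 0`. [folklore] -/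
theorem inv_factorial_mul_pow_odd_le {a b : ℝ} (ha : 0 ≤ a) (hb : 0 ≤ b) (n : ℕ) :
    ((n ! : ℝ))⁻¹ * (a ^ n * ((((n * 2 + 1 : ℕ) : ℝ)) * b) ^ (n + 1)) ≤
      3 * Real.exp 1 * b * ((n : ℝ) + 1) * (3 * Real.exp 1 * a * b) ^ n := by
  have hfac : (0 : ℝ) < n ! := by exact_mod_cast Nat.factorial_pos n
  have hfac1 : (0 : ℝ) < (n + 1) ! := by exact_mod_cast Nat.factorial_pos (n + 1)
  -- `(2n+1) ≤ 3(n+1)`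
  have h3 : (((n * 2 + 1 : ℕ) : ℝ)) * b ≤ 3 * ((n : ℝ) + 1) * b := by
    have : (((n * 2 + 1 : ℕ) : ℝ)) ≤ 3 * ((n : ℝ) + 1) := by push_cast; linarith
    exact mul_le_mul_of_nonneg_right this hb
  -- `(n+1)^{n+1} ≤ e^{n+1} (n+1)!`
  have hexp : ((n : ℝ) + 1) ^ (n + 1) ≤ Real.exp 1 ^ (n + 1) * (n + 1) ! := by
    have key := Real.pow_div_factorial_le_exp ((n : ℝ) + 1) (by positivity) (n + 1)
    rw [div_le_iff₀ hfac1] at key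
    calc ((n : ℝ) + 1) ^ (n + 1) ≤ Real.exp ((n : ℝ) + 1) * (n + 1) ! := key
      _ = Real.exp 1 ^ (n + 1) * (n + 1) ! := by
          rw [← Real.exp_nat_mul, mul_one]
          push_cast
          ring_nf
  calc ((n ! : ℝ))⁻¹ * (a ^ n * ((((n * 2 + 1 : ℕ) : ℝ)) * b) ^ (n + 1))
      ≤ ((n ! : ℝ))⁻¹ * (a ^ n * (3 * ((n : ℝ) + 1) * b) ^ (n + 1)) := by
        gcongr
    _ = ((n ! : ℝ))⁻¹ * (a ^ n * (3 * b) ^ (n + 1)) * ((n : ℝ) + 1) ^ (n + 1) := by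
        rw [show 3 * ((n : ℝ) + 1) * b = (3 * b) * ((n : ℝ) + 1) by ring, mul_pow]
        ring
    _ ≤ ((n ! : ℝ))⁻¹ * (a ^ n * (3 * b) ^ (n + 1)) * (Real.exp 1 ^ (n + 1) * (n + 1) !) := by
        gcongr
    _ = 3 * Real.exp 1 * b * ((n : ℝ) + 1) * (3 * Real.exp 1 * a * b) ^ n := by
        rw [Nat.factorial_succ]
        push_cast
        field_simp
        ring

/-- The geometric–linear dominating series is summable for `3e·a·b < 1`. [folklore] -/
theorem summable_twoPointBound {a b : ℝ} (ha : 0 ≤ a) (hb : 0 ≤ b) (hr : 3 * Real.exp 1 * a * b < 1) :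
    Summable fun n : ℕ => 3 * Real.exp 1 * b * ((n : ℝ) + 1) * (3 * Real.exp 1 * a * b) ^ n := by
  have hr0 : 0 ≤ 3 * Real.exp 1 * a * b := by positivity
  have hnorm : ‖3 * Real.exp 1 * a * b‖ < 1 := by rwa [Real.norm_eq_abs, abs_of_nonneg hr0]
  have h1 := (summable_pow_mul_geometric_of_norm_lt_one 1 hnorm).mul_left (3 * Real.exp 1 * b)
  have h2 := (summable_geometric_of_lt_one hr0 hr).mul_left (3 * Real.exp 1 * b)
  have hfun : (fun n : ℕ => 3 * Real.exp 1 * b * ((n : ℝ) + 1) * (3 * Real.exp 1 * a * b) ^ n) =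
      fun n : ℕ => 3 * Real.exp 1 * b * ((n : ℝ) ^ 1 * (3 * Real.exp 1 * a * b) ^ n) +
        3 * Real.exp 1 * b * (3 * Real.exp 1 * a * b) ^ n := by
    funext n
    ring
  rw [hfun]
  exact h1.add h2

end Series

/-! ### B. The two-point numerator: uniform bounds and the limit of the series -/

section TwoPointSeries

variable {L : ℕ} [NeZero L]

/-- **Uniform bound on the two-point moments**: for `β > 0` and equal external times `0`,
`‖∫dμ_{C_M} ψ⁺ψ⁻ Vⁿ‖ ≤ (|U|L²β)ⁿ ((2n+1)B²)^{n+1}`, `B = L⁻² Σ_{k⃗}(2 + β|ξ_{k⃗}|/3)`, uniformly in `M`.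
[cite: BenfattoGiulianiMastropietro2006, §2.1 (2.8)] -/
theorem norm_gaussExpect_twoPoint_pow_le {M : ℕ} {β : ℝ} (hβ : 0 < β) (μ U : ℝ) (σ σ' : Fin 2)
    (xe ye : TorusSite 2 L) (n : ℕ) :
    ‖gaussExpect ℂ (hubbardCovariance L M β μ 0)
        (positionField L M β 0 σ xe 0 * positionField L M β 1 σ' ye 0 * hubbardInteraction L M β U ^ n)‖ ≤
      (|U| * (L : ℝ) ^ 2 * β) ^ n * ((((n * 2 + 1 : ℕ) : ℝ)) *
        ((1 / (L : ℝ) ^ 2) * ∑ q : TorusSite 2 L, (2 + β * |nambuXi L μ q| / 3)) ^ 2) ^ (n + 1) := by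
  set B : ℝ := (1 / (L : ℝ) ^ 2) * ∑ q : TorusSite 2 L, (2 + β * |nambuXi L μ q| / 3) with hB
  have hB2 : 2 ≤ B := two_le_vertexEntryBound (L := L) hβ.le μ
  have h1 : 1 ≤ (((n * 2 + 1 : ℕ) : ℝ)) * B ^ 2 := by
    have : (1 : ℝ) ≤ ((n * 2 + 1 : ℕ) : ℝ) := by exact_mod_cast Nat.succ_le_succ (Nat.zero_le _)
    nlinarith
  have hcard : ((Fintype.card (Fin n → TorusSite 2 L) : ℕ) : ℝ) = ((L : ℝ) ^ 2) ^ n := by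
    rw [Fintype.card_fun, Fintype.card_fin, Nat.cast_pow, Fintype.card_pi, prod_const, ZMod.card, card_univ,
      Fintype.card_fin, Nat.cast_pow]
  have hvol : (volume : Measure (Fin n → ℝ)).real (Set.Icc (0 : Fin n → ℝ) fun _ => β) = β ^ n := by
    rw [measureReal_def, Real.volume_Icc_pi_toReal (a := 0) (b := fun _ => β) (fun _ => hβ.le)]
    simp
  rw [gaussExpect_twoPoint_mul_hubbardInteraction_pow_eq_det hβ, norm_mul, norm_pow, Complex.norm_real,
    Real.norm_eq_abs]
  have hdet : ∀ x : Fin n → TorusSite 2 L, ‖∫ τ in Set.Icc (0 : Fin n → ℝ) (fun _ => β),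
      (Matrix.of fun i j : Fin (n * 2 + 1) =>
        -((vertexSubMatrix L M β (Fin.append x ![xe, ye]) (Fin.append τ ![(0 : ℝ), 0])).transpose *
            hubbardCovariance L M β μ 0 *
            vertexSubMatrix L M β (Fin.append x ![xe, ye]) (Fin.append τ ![(0 : ℝ), 0]))
          ((twoPointPlusEnum n σ i, 0) : VertexLeg (n + 2)) ((twoPointMinusEnum n σ' j, 1) : VertexLeg (n + 2))).det‖ ≤
      ((((n * 2 + 1 : ℕ) : ℝ)) * B ^ 2) ^ (n + 1) * β ^ n := by
    intro x
    rw [← hvol]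
    refine norm_setIntegral_le_of_norm_le_const (Literature.Analysis.Matrix.volume_Icc_cube_ne_top β).lt_top
      fun τ _ => norm_det_le_of_entry_le_odd _ h1 fun i j => ?_
    rw [Matrix.of_apply]
    exact norm_vertexWickEntry_le hβ μ _ _ M _ _ _ _
  calc |U| ^ n * ‖∑ x : Fin n → TorusSite 2 L, _‖
      ≤ |U| ^ n * ∑ x : Fin n → TorusSite 2 L, ((((n * 2 + 1 : ℕ) : ℝ)) * B ^ 2) ^ (n + 1) * β ^ n := by
        gcongr
        exact (norm_sum_le _ _).trans (sum_le_sum fun x _ => hdet x)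
    _ = (|U| * (L : ℝ) ^ 2 * β) ^ n * ((((n * 2 + 1 : ℕ) : ℝ)) * B ^ 2) ^ (n + 1) := by
        rw [sum_const, card_univ, nsmul_eq_mul, hcard]
        ring

/-- **The `M → ∞` limit of the Grassmann two-point numerator is the determinant series** (equal external times `0`):
for `β > 0` and `3e|U|L²βB² < 1`,
`∫dμ_{C_M} ψ⁺_{xₑσ}ψ⁻_{yₑσ'} e^{−V} ⟶ Σ'_n ((−1)ⁿ/n!) Uⁿ Σ_{x⃗} ∫_{[0,β]ⁿ} det[vertexLimitEntry on the 2n+1 pairs]`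
(Tannery with the Hadamard domination). [cite: BenfattoGiulianiMastropietro2006, §2.1 (2.8)] -/
theorem tendsto_gaussExpect_twoPoint_mul_grassmannExp {β : ℝ} (hβ : 0 < β) (μ : ℝ) {U : ℝ} (σ σ' : Fin 2)
    (xe ye : TorusSite 2 L)
    (hU : 3 * Real.exp 1 * (|U| * (L : ℝ) ^ 2 * β) *
      ((1 / (L : ℝ) ^ 2) * ∑ q : TorusSite 2 L, (2 + β * |nambuXi L μ q| / 3)) ^ 2 < 1) :
    Tendsto (fun M : ℕ => gaussExpect ℂ (hubbardCovariance L M β μ 0)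
        (positionField L M β 0 σ xe 0 * positionField L M β 1 σ' ye 0 * grassmannExp (-(hubbardInteraction L M β U))))
      atTop
      (𝓝 (∑' n : ℕ, ((-1 : ℂ) ^ n * ((n ! : ℂ))⁻¹) * ((U : ℂ) ^ n * ∑ x : Fin n → TorusSite 2 L,
        ∫ τ in Set.Icc (0 : Fin n → ℝ) (fun _ => β),
          (Matrix.of fun i j : Fin (n * 2 + 1) =>
            vertexLimitEntry L β μ ((Fin.append x ![xe, ye] : Fin (n + 2) → TorusSite 2 L) (twoPointPlusEnum n σ i).1)
              ((Fin.append x ![xe, ye] : Fin (n + 2) → TorusSite 2 L) (twoPointMinusEnum n σ' j).1)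
              (twoPointPlusEnum n σ i).2 (twoPointMinusEnum n σ' j).2
              ((Fin.append τ ![(0 : ℝ), 0] : Fin (n + 2) → ℝ) (twoPointMinusEnum n σ' j).1 -
                (Fin.append τ ![(0 : ℝ), 0] : Fin (n + 2) → ℝ) (twoPointPlusEnum n σ i).1)).det))) := by
  set B : ℝ := (1 / (L : ℝ) ^ 2) * ∑ q : TorusSite 2 L, (2 + β * |nambuXi L μ q| / 3) with hB
  have hB0 : 0 ≤ B := le_trans (by norm_num) (two_le_vertexEntryBound (L := L) hβ.le μ)
  set a : ℝ := |U| * (L : ℝ) ^ 2 * β with ha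
  have ha0 : 0 ≤ a := by positivity
  have hZ : ∀ M : ℕ, gaussExpect ℂ (hubbardCovariance L M β μ 0)
      (positionField L M β 0 σ xe 0 * positionField L M β 1 σ' ye 0 * grassmannExp (-(hubbardInteraction L M β U))) =
      ∑' n : ℕ, ((-1 : ℂ) ^ n * ((n ! : ℂ))⁻¹) * gaussExpect ℂ (hubbardCovariance L M β μ 0)
        (positionField L M β 0 σ xe 0 * positionField L M β 1 σ' ye 0 * hubbardInteraction L M β U ^ n) := fun M =>
    gaussExpect_mul_grassmannExp_neg_eq_tsum _ _ (constPart_hubbardInteraction L M β U)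
  simp_rw [hZ]
  refine tendsto_tsum_of_dominated_convergence
    (bound := fun n => 3 * Real.exp 1 * B ^ 2 * ((n : ℝ) + 1) * (3 * Real.exp 1 * a * B ^ 2) ^ n) ?_ (fun n => ?_) ?_
  · exact summable_twoPointBound ha0 (by positivity) (by rw [ha, hB]; exact hU)
  · exact (tendsto_gaussExpect_twoPoint_mul_hubbardInteraction_pow hβ μ U σ σ' xe ye ⟨le_rfl, hβ⟩ ⟨le_rfl, hβ⟩ n).const_mul _
  · refine Eventually.of_forall fun M n => ?_
    rw [norm_mul, norm_mul, norm_pow, norm_neg, norm_one, one_pow, one_mul, norm_inv, Complex.norm_natCast]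
    calc ((n ! : ℝ))⁻¹ * ‖gaussExpect ℂ (hubbardCovariance L M β μ 0)
          (positionField L M β 0 σ xe 0 * positionField L M β 1 σ' ye 0 * hubbardInteraction L M β U ^ n)‖
        ≤ ((n ! : ℝ))⁻¹ * (a ^ n * ((((n * 2 + 1 : ℕ) : ℝ)) * B ^ 2) ^ (n + 1)) := by
          gcongr
          rw [ha, hB]
          exact norm_gaussExpect_twoPoint_pow_le hβ μ U σ σ' xe ye n
      _ ≤ _ := inv_factorial_mul_pow_odd_le ha0 (by positivity) n

end TwoPointSeries

/-! ### C. Cube reflection; the limiting two-point determinant -/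

section Reflection

/-- **Reflection invariance of the unit cube**: `∫_{[0,1]^k} Φ(1 − u) du = ∫_{[0,1]^k} Φ(u) du`. [folklore] -/
theorem setIntegral_unit_cube_comp_one_sub {k : ℕ} (Φ : (Fin k → ℝ) → ℂ) :
    ∫ u in Set.pi Set.univ (fun _ : Fin k => Set.Icc (0 : ℝ) 1), Φ (fun i => 1 - u i) =
      ∫ u in Set.pi Set.univ (fun _ : Fin k => Set.Icc (0 : ℝ) 1), Φ u := by
  have hmp : MeasurePreserving (fun u : Fin k → ℝ => fun i => 1 - u i) volume volume :=
    volume_preserving_pi fun _ : Fin k => Measure.measurePreserving_sub_left (volume : Measure ℝ) (1 : ℝ)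
  have hme : MeasurableEmbedding (fun u : Fin k → ℝ => fun i => 1 - u i) :=
    (MeasurableEquiv.piCongrRight fun _ : Fin k => MeasurableEquiv.subLeft (1 : ℝ)).measurableEmbedding
  have hpre : (fun u : Fin k → ℝ => fun i => 1 - u i) ⁻¹' (Set.pi Set.univ fun _ : Fin k => Set.Icc (0 : ℝ) 1) =
      Set.pi Set.univ fun _ : Fin k => Set.Icc (0 : ℝ) 1 := by
    ext u
    simp only [Set.mem_preimage, Set.mem_univ_pi, Set.mem_Icc]
    exact ⟨fun h i => ⟨by linarith [(h i).2], by linarith [(h i).1]⟩,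
      fun h i => ⟨by linarith [(h i).2], by linarith [(h i).1]⟩⟩
  have key := hmp.setIntegral_preimage_emb hme Φ (Set.pi Set.univ fun _ : Fin k => Set.Icc (0 : ℝ) 1)
  rw [hpre] at key
  exact key

end Reflection

section LimitDet

variable (L : ℕ) [NeZero L]

/-- **The limiting two-point Wick determinant** of `ψ⁺_{(x⃗ₑ,0)σ}ψ⁻_{(y⃗ₑ,0)σ'}` with `n` vertices at sites `x⃗` and times
`τ`: `det[vertexLimitEntry(x⃗'_{pᵢ}, x⃗'_{qⱼ}, σᵢ, σⱼ; τ'_{qⱼ} − τ'_{pᵢ})]_{i,j ≤ 2n}`, `x⃗' = (x⃗, x⃗ₑ, y⃗ₑ)`, `τ' = (τ, 0, 0)`,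
`(pᵢ,σᵢ) = twoPointPlusEnum`, `(qⱼ,σⱼ) = twoPointMinusEnum` (the `M → ∞` limit of the two-point moments,
`tendsto_gaussExpect_twoPoint_mul_hubbardInteraction_pow`). [cite: BenfattoGiulianiMastropietro2006, §2.1 (2.8)] -/
def twoPointLimitDet (β μ : ℝ) (σ σ' : Fin 2) (xe ye : TorusSite 2 L) {n : ℕ} (x : Fin n → TorusSite 2 L)
    (τ : Fin n → ℝ) : ℂ :=
  (Matrix.of fun i j : Fin (n * 2 + 1) =>
    vertexLimitEntry L β μ ((Fin.append x ![xe, ye] : Fin (n + 2) → TorusSite 2 L) (twoPointPlusEnum n σ i).1)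
      ((Fin.append x ![xe, ye] : Fin (n + 2) → TorusSite 2 L) (twoPointMinusEnum n σ' j).1)
      (twoPointPlusEnum n σ i).2 (twoPointMinusEnum n σ' j).2
      ((Fin.append τ ![(0 : ℝ), 0] : Fin (n + 2) → ℝ) (twoPointMinusEnum n σ' j).1 -
        (Fin.append τ ![(0 : ℝ), 0] : Fin (n + 2) → ℝ) (twoPointPlusEnum n σ i).1)).det

variable {L}

/-- The limiting entries are measurable in the time difference. [folklore] -/
theorem measurable_vertexLimitEntry (β μ : ℝ) (xa xb : TorusSite 2 L) (σ σ' : Fin 2) :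
    Measurable fun s : ℝ => vertexLimitEntry L β μ xa xb σ σ' s := by
  simp only [vertexLimitEntry_eq_torusChar]
  refine Measurable.neg ?_
  split_ifs
  · exact measurable_const.mul (Finset.measurable_sum _ fun q _ => measurable_const.mul
      (Complex.measurable_ofReal.comp (measurable_timeOrderedPropagator β _)))
  · exact measurable_const

/-- The limiting two-point determinant is measurable in the vertex times. [folklore] -/
theorem measurable_twoPointLimitDet (β μ : ℝ) (σ σ' : Fin 2) (xe ye : TorusSite 2 L) {n : ℕ}
    (x : Fin n → TorusSite 2 L) : Measurable fun τ : Fin n → ℝ => twoPointLimitDet L β μ σ σ' xe ye x τ := by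
  unfold twoPointLimitDet
  simp only [Matrix.det_apply', Matrix.of_apply]
  refine Finset.measurable_sum _ fun ρ _ => measurable_const.mul (Finset.measurable_prod _ fun i _ => ?_)
  refine (measurable_vertexLimitEntry β μ _ _ _ _).comp ?_
  exact ((measurable_pi_apply _).comp (continuous_append_const _).measurable).sub
    ((measurable_pi_apply _).comp (continuous_append_const _).measurable)

/-- Bound on the cube: `‖twoPointLimitDet x τ‖ ≤ ((2n+1)B₁²)^{n+1}`, `B₁ = L⁻² Σ_q e^{β|ξ_q|}`, for `τ ∈ [0,β]ⁿ`
(all times of the `n + 2` points lie in `[0, β]`). [folklore] -/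
theorem norm_twoPointLimitDet_le {β : ℝ} (hβ : 0 ≤ β) (μ : ℝ) (σ σ' : Fin 2) (xe ye : TorusSite 2 L) {n : ℕ}
    (x : Fin n → TorusSite 2 L) {τ : Fin n → ℝ} (hτ : τ ∈ Set.Icc (0 : Fin n → ℝ) (fun _ => β)) :
    ‖twoPointLimitDet L β μ σ σ' xe ye x τ‖ ≤
      (((n * 2 + 1 : ℕ) : ℝ) * ((1 / (L : ℝ) ^ 2) * ∑ q : TorusSite 2 L, Real.exp (β * |nambuXi L μ q|)) ^ 2) ^ (n + 1) := by
  have hL : (0 : ℝ) < (L : ℝ) ^ 2 := by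
    have : (0 : ℝ) < L := by exact_mod_cast Nat.pos_of_ne_zero (NeZero.ne L)
    positivity
  -- the entry bound `B₁ ≥ 1`
  have hB1 : 1 ≤ (1 / (L : ℝ) ^ 2) * ∑ q : TorusSite 2 L, Real.exp (β * |nambuXi L μ q|) := by
    have hcard : ((Fintype.card (TorusSite 2 L) : ℕ) : ℝ) = (L : ℝ) ^ 2 := by
      rw [Fintype.card_pi, prod_const, ZMod.card, card_univ, Fintype.card_fin, Nat.cast_pow]
    have hsum : ∑ _q : TorusSite 2 L, (1 : ℝ) ≤ ∑ q : TorusSite 2 L, Real.exp (β * |nambuXi L μ q|) :=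
      sum_le_sum fun q _ => Real.one_le_exp (by positivity)
    rw [sum_const, card_univ, nsmul_eq_mul, hcard, mul_one] at hsum
    calc (1 : ℝ) = (1 / (L : ℝ) ^ 2) * (L : ℝ) ^ 2 := by rw [one_div_mul_cancel hL.ne']
      _ ≤ _ := by gcongr
  have h1 : 1 ≤ ((n * 2 + 1 : ℕ) : ℝ) *
      ((1 / (L : ℝ) ^ 2) * ∑ q : TorusSite 2 L, Real.exp (β * |nambuXi L μ q|)) ^ 2 := by
    have : (1 : ℝ) ≤ ((n * 2 + 1 : ℕ) : ℝ) := by exact_mod_cast Nat.succ_le_succ (Nat.zero_le _)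
    nlinarith
  refine norm_det_le_of_entry_le_odd _ h1 fun i j => ?_
  rw [Matrix.of_apply]
  refine norm_vertexLimitEntry_le β μ _ _ _ _ ?_
  have hall : ∀ r : Fin (n + 2), 0 ≤ (Fin.append τ ![(0 : ℝ), 0] : Fin (n + 2) → ℝ) r ∧
      (Fin.append τ ![(0 : ℝ), 0] : Fin (n + 2) → ℝ) r ≤ β := by
    intro r
    refine Fin.addCases (fun i => ?_) (fun j => ?_) r
    · rw [Fin.append_left]; exact ⟨hτ.1 i, hτ.2 i⟩
    · rw [Fin.append_right]
      fin_cases j <;> exact ⟨le_rfl, hβ⟩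
  rw [abs_le]
  constructor <;> linarith [(hall (twoPointPlusEnum n σ i).1).1, (hall (twoPointPlusEnum n σ i).1).2,
    (hall (twoPointMinusEnum n σ' j).1).1, (hall (twoPointMinusEnum n σ' j).1).2]

/-- The permutation of the `2n+1` pairs induced by a permutation of the vertices (pair `0` fixed). [folklore] -/
def twoPointPairPerm {n : ℕ} (ρ : Equiv.Perm (Fin n)) : Equiv.Perm (Fin (n * 2 + 1)) :=
  ((finSuccEquiv (n * 2)).trans (Equiv.optionCongr (pairPerm ρ))).trans (finSuccEquiv (n * 2)).symm

omit [NeZero L] in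
/-- The induced permutation fixes the external pair. [folklore] -/
@[simp] theorem twoPointPairPerm_zero {n : ℕ} (ρ : Equiv.Perm (Fin n)) : twoPointPairPerm ρ 0 = 0 := by
  simp [twoPointPairPerm]

omit [NeZero L] in
/-- The induced permutation acts on the vertex pairs by `pairPerm`. [folklore] -/
@[simp] theorem twoPointPairPerm_succ {n : ℕ} (ρ : Equiv.Perm (Fin n)) (m : Fin (n * 2)) :
    twoPointPairPerm ρ m.succ = (pairPerm ρ m).succ := by
  simp [twoPointPairPerm]

/-- **Joint relabelling of the vertices does not change the limiting two-point determinant.** [folklore] -/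
theorem twoPointLimitDet_perm (β μ : ℝ) (σ σ' : Fin 2) (xe ye : TorusSite 2 L) {n : ℕ} (ρ : Equiv.Perm (Fin n))
    (x : Fin n → TorusSite 2 L) (τ : Fin n → ℝ) :
    twoPointLimitDet L β μ σ σ' xe ye (fun a => x (ρ a)) (fun a => τ (ρ a)) = twoPointLimitDet L β μ σ σ' xe ye x τ := by
  rw [twoPointLimitDet, twoPointLimitDet]
  conv_rhs => rw [← Matrix.det_submatrix_equiv_self (twoPointPairPerm ρ)]
  congr 1
  ext i j
  simp only [Matrix.submatrix_apply, Matrix.of_apply]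
  refine Fin.cases ?_ (fun m => ?_) i <;> refine Fin.cases ?_ (fun m' => ?_) j <;>
    simp only [twoPointPairPerm_zero, twoPointPairPerm_succ, twoPointPlusEnum_zero, twoPointMinusEnum_zero,
      twoPointPlusEnum_succ, twoPointMinusEnum_succ, finProdFinEquiv_symm_pairPerm, Fin.append_left, Fin.append_right]

/-- **The vertex sum of the limiting two-point determinants is symmetric in the vertex times.** [folklore] -/
theorem sum_twoPointLimitDet_perm (β μ : ℝ) (σ σ' : Fin 2) (xe ye : TorusSite 2 L) {n : ℕ} (g : (Fin n → ℝ) → Fin n → ℝ)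
    (hg : ∀ (ρ : Equiv.Perm (Fin n)) (w : Fin n → ℝ), g (fun a => w (ρ a)) = fun a => g w (ρ a))
    (ρ : Equiv.Perm (Fin n)) (w : Fin n → ℝ) :
    ∑ x : Fin n → TorusSite 2 L, twoPointLimitDet L β μ σ σ' xe ye x (g fun a => w (ρ a)) =
      ∑ x : Fin n → TorusSite 2 L, twoPointLimitDet L β μ σ σ' xe ye x (g w) := by
  rw [hg]
  calc ∑ x : Fin n → TorusSite 2 L, twoPointLimitDet L β μ σ σ' xe ye x (fun a => g w (ρ a))
      = ∑ x : Fin n → TorusSite 2 L, twoPointLimitDet L β μ σ σ' xe ye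
          (fun a => ((Equiv.arrowCongr ρ.symm (Equiv.refl (TorusSite 2 L))) x) a) (fun a => g w (ρ a)) := by
        rw [← (Equiv.arrowCongr ρ.symm (Equiv.refl (TorusSite 2 L))).sum_comp]
    _ = ∑ x : Fin n → TorusSite 2 L, twoPointLimitDet L β μ σ σ' xe ye (fun a => x (ρ a)) (fun a => g w (ρ a)) := by
        refine sum_congr rfl fun x _ => ?_
        congr 1
    _ = _ := sum_congr rfl fun x _ => twoPointLimitDet_perm β μ σ σ' xe ye ρ x (g w)

/-- The vertex sum is integrable on the unit cube in the reflected scaled variables `τ = β(1 − u)`. [folklore] -/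
theorem integrableOn_sum_twoPointLimitDet_reflect {β : ℝ} (hβ : 0 < β) (μ : ℝ) (σ σ' : Fin 2) (xe ye : TorusSite 2 L)
    (n : ℕ) :
    IntegrableOn (fun u : Fin n → ℝ => ∑ x : Fin n → TorusSite 2 L,
        twoPointLimitDet L β μ σ σ' xe ye x (fun a => β * (1 - u a)))
      (Set.pi Set.univ fun _ : Fin n => Set.Icc (0 : ℝ) 1) volume := by
  have hset : Set.pi Set.univ (fun _ : Fin n => Set.Icc (0 : ℝ) 1) = Set.Icc (0 : Fin n → ℝ) (fun _ => 1) :=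
    Set.pi_univ_Icc _ _
  rw [hset]
  have hmeas : Measurable fun u : Fin n → ℝ => (fun a => β * (1 - u a) : Fin n → ℝ) :=
    measurable_pi_iff.2 fun a => (measurable_const.mul (measurable_const.sub (measurable_pi_apply a)))
  refine integrableOn_of_measurable_of_norm_le measurableSet_Icc
    (Literature.Analysis.Matrix.volume_Icc_cube_ne_top 1)
    (Finset.measurable_sum _ fun x _ => (measurable_twoPointLimitDet β μ σ σ' xe ye x).comp hmeas)
    (B := ∑ _x : Fin n → TorusSite 2 L, (((n * 2 + 1 : ℕ) : ℝ) *
      ((1 / (L : ℝ) ^ 2) * ∑ q : TorusSite 2 L, Real.exp (β * |nambuXi L μ q|)) ^ 2) ^ (n + 1))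
    fun u hu => (norm_sum_le _ _).trans (sum_le_sum fun x _ => norm_twoPointLimitDet_le hβ.le μ σ σ' xe ye x ?_)
  refine ⟨fun a => ?_, fun a => ?_⟩
  · have := hu.2 a
    simp only [Pi.zero_apply] at this ⊢
    nlinarith
  · have := hu.1 a
    simp only [Pi.zero_apply] at this ⊢
    nlinarith

/-- The limiting two-point determinant is integrable on the time cube `[0,β]ⁿ`. [folklore] -/
theorem integrableOn_twoPointLimitDet {β : ℝ} (hβ : 0 ≤ β) (μ : ℝ) (σ σ' : Fin 2) (xe ye : TorusSite 2 L) {n : ℕ}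
    (x : Fin n → TorusSite 2 L) :
    IntegrableOn (fun τ : Fin n → ℝ => twoPointLimitDet L β μ σ σ' xe ye x τ) (Set.Icc (0 : Fin n → ℝ) fun _ => β) volume :=
  integrableOn_of_measurable_of_norm_le measurableSet_Icc (Literature.Analysis.Matrix.volume_Icc_cube_ne_top β)
    (measurable_twoPointLimitDet β μ σ σ' xe ye x) fun _ hτ => norm_twoPointLimitDet_le hβ μ σ σ' xe ye x hτ

end LimitDet

end Literature.MathematicalPhysics.QuantumLattice
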